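import Literature.Analysis.FluidPDE.ESSLocalHolderNoConcentration
import Literature.Analysis.FluidPDE.NSBoundedHigherRegularityQuantProofs
import HarnessLib

/-!
# Vanishing of a local energy ancient solution from far-field boundedness, weak vanishing at
# the top time and a Liouville property of its slices (the endgame of ESS 2003, Thm. 1.4, with
# local pressure bounds)

Analysis/FluidPDE proofs-only file (theorems only: no definition, no named fact; nothing accepted
is restated or changed). The blow-up/backward-uniqueness endgame of L. Escauriaza, G. Seregin,
V. Šverák, *`L_{3,∞}`-solutions of Navier–Stokes equations and backward uniqueness*, Russ. Math.
Surveys 58 (2003), §3 after (3.24) (in the form of G. Seregin, *Lecture notes on regularity theory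
for the Navier–Stokes equations* (2014), §6.6 Thm. 6.21 and Ch. 7 p. 139) is carried out in the
tree in `ESSLocalHolderNoConcentration.lean` for the blow-up limit of an `L_{3,∞}` pair: there the
pressure of the limit lies in `L^{3/2}` of every slab `]-T, 0[ × ℝ³` and the velocity slices lie in
`L³(ℝ³)`, and both facts are used — the first to feed Serrin's quantitative interior regularity
(`NSBoundedHigherRegularityBounds`, now the theorem `NSBoundedHigherRegularityBounds_holds`), the
second in the very last line, the Liouville theorem for harmonic functions in `L³`.

Neither is available for the blow-up limit of a solution that is merely bounded in a critical
Besov space `Ḃ^{-1+3/p}_{p,q}`, `3 < p, q < ∞` (W. Wang, Z. Zhang, *Blow-up of critical norms for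
the 3-D Navier–Stokes equations*, Sci. China Math. 60 (2017) 637–650 = arXiv:1510.02589, §4,
Steps 1–3, the Besov version of the ESS scheme; D. Albritton, Anal. PDE 11 (2018), §3): its
pressure is only locally in `L^{3/2}` with uniform local bounds, and its slices are in
`L²_{uloc} ∩ Ḃ^{-1+3/p}_{p,q}`, not in `L³`. This file re-runs the endgame with exactly these two
inputs abstracted:

* the global pressure hypothesis is replaced by a **uniform local bound**
  `∫_{Q(z₀,1)} |π|^{3/2} ≤ P` for all apices `z₀` with `t₀ ≤ 0` — which is all that Serrin's local
  theory consumes (`exists_smooth_representative_of_locally_bounded`);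
* the `L³` Liouville step is replaced by the **abstract Liouville property of the slices**
  `hL`: for a.e. `t`, no non-zero entire harmonic field agrees a.e. with `w(t, ·)` (for `L³`
  slices this is `eq_zero_of_harmonic_memLp_inner`; for `L²_{uloc} ∩ Ḃ^{s}_{p,q}` slices, `s < 0`,
  it is the boundedness of uniformly locally `L²` harmonic functions, Liouville, and the vanishing
  of constants in homogeneous Besov spaces — proved where it is used).

Everything else is the accepted machinery, called as is: CKN regular times
(`ae_forall_isRegularPoint`), bounded strips (`exists_strip_bound`), the far-field backward
uniqueness across half-spaces (`farField_curl_eq_zero`), the class-`C¹₂` vorticity calculus and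
Carleman unique continuation (`vorticity_c12_of_isDistributionalNSSolutionOn`,
`vorticity_carleman_inequality`, `Carleman.uniqueContinuation_uncurried_c12`), and
`laplacian_eq_zero_of_curl_eq_zero_of_isDivFree`.

## Contents

* `exists_representative_of_ae_bound_of_local_pressure` — smooth representative with bounded
  derivatives on a region carrying an a.e. velocity bound, from the uniform local pressure bound;
* `farField_representative_of_local_pressure` — the far-field representative of the ancient
  solution and the vanishing of its vorticity beyond `R₀ + 2`;
* `strip_velocity_ae_zero_of_liouville` — the interior step on a bounded strip, ending with `hL`;
* `ancient_ae_slice_zero_of_farField_of_top_of_liouville` — **the endgame**: a pair `(w, π)`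
  suitable in every `Q(a)`, with uniform local pressure bounds, weakly vanishing at the top time,
  bounded by `1` a.e. on `]-2, 0[ × {|x| > R₀}`, whose slices have the Liouville property for a.e.
  `t ∈ ]-1, 0[`, satisfies `w(t, ·) = 0` a.e. for a.e. `t ∈ ]-1, 0[`;
* `ancient_lintegral_cube_half_eq_zero_of_farField_of_top_of_liouville` — hence
  `∫_{Q(1/2)} |w|³ = 0` (the shape contradicting `blowup_lintegral_cube_ge_of`).

## References

* L. Escauriaza, G. Seregin, V. Šverák, Russ. Math. Surveys 58 (2003) 211–250, Thm. 1.4, §3,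
  Thms. 4.1, 5.1. [EscauriazaSereginSverak2003]
* G. Seregin, *Lecture notes on regularity theory for the Navier–Stokes equations*, World
  Scientific (2014), §6.6 Thm. 6.21 and Ch. 7 p. 139. [Seregin2014]
* W. Wang, Z. Zhang, Sci. China Math. 60 (2017) 637–650 = arXiv:1510.02589, §4 Steps 1–3.
  [WangZhang2016]
* J. C. Robinson, J. L. Rodrigo, W. Sadowski, *The three-dimensional Navier–Stokes equations*,
  CUP (2016), proof of Thm. 16.2, Steps 3–5. [RobinsonRodrigoSadowski2016]
-/

noncomputable section

open MeasureTheory TopologicalSpace Set Function Filter Metric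
open _root_.Topology
open scoped ENNReal NNReal InnerProductSpace RealInnerProductSpace Laplacian

namespace Literature.Analysis.FluidPDE

variable {w : ℝ → EuclideanSpace ℝ (Fin 3) → EuclideanSpace ℝ (Fin 3)}
  {π : ℝ → EuclideanSpace ℝ (Fin 3) → ℝ}

/-! ### Smooth representative from a uniform local pressure bound -/

section Representative

/-- **Smooth representative on a bounded-velocity region, from uniform local pressure bounds**
(ESS 2003, §3, (3.26)–(3.30), with Serrin's quantitative interior regularity
`NSBoundedHigherRegularityBounds_holds`). Let `(w, π)` be a suitable weak solution in every
cylinder `Q(a)`, with `∫_{Q(z₀,1)} |π|^{3/2} ≤ P` for every apex `z₀` with `t₀ ≤ 0`. Let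
`]a, b[ × S`, `S` open, `b ≤ 0`, `0 < ρ ≤ 1/2`, and suppose `|w| ≤ L` a.e. on
`]a - 4ρ², b[ × S'` where `S'` contains the `2ρ`-ball around every point of `S`. Then `w` has a
representative `U` on `]a, b[ × S`: jointly continuous, with `C^∞` slices, all spatial derivatives
jointly continuous, and `‖D_xⁿ U‖ ≤ K` for `n ≤ 4` (`exists_smooth_representative_of_locally_bounded`
on the cylinders `Q((min(t+ρ², b), x), 2ρ) ⊆ Q((min(t+ρ², b), x), 1)`). [cite: EscauriazaSereginSverak2003, §3 (3.26)–(3.30)] -/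
theorem exists_representative_of_ae_bound_of_local_pressure
    (hw : ∀ a : ℝ, 0 < a →
      IsSuitableWeakSolutionInBall a (0 : ℝ × EuclideanSpace ℝ (Fin 3)) w π)
    {P : ℝ≥0} (hP : ∀ z₀ : ℝ × EuclideanSpace ℝ (Fin 3), z₀.1 ≤ 0 →
      ∫⁻ q in parabolicCylinder 1 z₀, ‖π q.1 q.2‖ₑ ^ (3 / 2 : ℝ) ≤ P)
    {a b ρ L : ℝ} {S S' : Set (EuclideanSpace ℝ (Fin 3))} (hS : IsOpen S) (hρ : 0 < ρ)
    (hρ1 : 2 * ρ ≤ 1) (hb : b ≤ 0)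
    (hSS' : ∀ x ∈ S, ball x (2 * ρ) ⊆ S')
    (hbd : ∀ᵐ z ∂(volume.restrict (Ioo (a - 4 * ρ ^ 2) b ×ˢ S')), ‖w z.1 z.2‖ ≤ L) :
    ∃ (K : ℝ) (U : ℝ → EuclideanSpace ℝ (Fin 3) → EuclideanSpace ℝ (Fin 3)),
      uncurry U =ᵐ[volume.restrict (Ioo a b ×ˢ S)] uncurry w ∧
      ContinuousOn (uncurry U) (Ioo a b ×ˢ S) ∧
      (∀ z ∈ Ioo a b ×ˢ S, ContDiffAt ℝ (⊤ : ℕ∞) (U z.1) z.2) ∧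
      (∀ n : ℕ, ContinuousOn
        (fun z : ℝ × EuclideanSpace ℝ (Fin 3) => iteratedFDeriv ℝ n (U z.1) z.2) (Ioo a b ×ˢ S)) ∧
      ∀ n ≤ 4, ∀ z ∈ Ioo a b ×ˢ S, ‖iteratedFDeriv ℝ n (U z.1) z.2‖ ≤ K := by
  -- the distributional formulation on every open region below `t = 0`
  have hdist : ∀ a' : ℝ, 0 < a' → IsDistributionalNSSolutionOn
      (parabolicCylinderOpens a' (0 : ℝ × EuclideanSpace ℝ (Fin 3))) 1 0 w π :=
    fun a' ha' => (hw a' ha').1.distributional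
  -- the cylinders around the points of the region
  have hcyl : ∀ z ∈ Ioo a b ×ˢ S,
      parabolicCylinder (2 * ρ) (min (z.1 + ρ ^ 2) b, z.2) ⊆ Ioo (a - 4 * ρ ^ 2) b ×ˢ ball z.2 (2 * ρ) := by
    rintro ⟨t, x⟩ ⟨ht, -⟩ ⟨s, y⟩ hq
    rw [mem_parabolicCylinder] at hq
    obtain ⟨⟨hs1, hs2⟩, hy⟩ := hq
    simp only at hs1 hs2 hy
    refine ⟨⟨?_, lt_of_lt_of_le hs2 (min_le_right _ _)⟩, mem_ball.2 hy⟩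
    have h1 : a < min (t + ρ ^ 2) b := lt_min (by linarith [ht.1, sq_nonneg ρ]) (ht.1.trans ht.2)
    nlinarith
  refine exists_smooth_representative_of_locally_bounded NSBoundedHigherRegularityBounds_holds
    (w := w) (π := π) hS (M := L) (P := P) hρ (fun z hz => ⟨?_, ?_, ?_⟩) 4
  · -- distributional solution in the cylinder
    refine isDistributionalNSSolutionOn_of_forall_cylinder hdist (isOpen_parabolicCylinder _ _) ?_
    intro q hq
    have hq' := hcyl z hz hq
    exact ⟨lt_of_lt_of_le hq'.1.2 hb, mem_univ _⟩
  · -- the velocity bound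
    refine ae_restrict_of_ae_restrict_of_subset ((hcyl z hz).trans ?_) hbd
    exact prod_mono Subset.rfl (hSS' z.2 hz.2)
  · -- the pressure bound, on the unit cylinder with the same apex
    have hapex : (min (z.1 + ρ ^ 2) b, z.2).1 ≤ (0 : ℝ) := (min_le_right _ _).trans hb
    exact (lintegral_mono_set (parabolicCylinder_mono (by positivity) hρ1 _)).trans (hP _ hapex)

end Representative

/-! ### The far-field representative and the vanishing of its vorticity -/

section FarField

/-- **The far-field representative of the ancient solution and the vanishing of its vorticity**
(ESS 2003, §3, (3.26)–(3.32); Seregin 2014, §6.6, Thm. 6.21; Wang–Zhang 2017, §4 Step 3, first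
half), with uniform local pressure bounds in place of `π ∈ L^{3/2}` of a slab. If `|w| ≤ 1` a.e.
on `]-2, 0[ × {|x| > R₀}`, then on `]-1, 0[ × {|x| > R₀ + 1}` the field `w` has a jointly
continuous representative `U` with smooth slices, and `curl U = 0` on `]-1, 0[ × {|x| > R₀ + 2}`
(`farField_curl_eq_zero`: backward uniqueness across the half-spaces, the vorticity vanishing at
the top time by the weak vanishing `htop`). [cite: EscauriazaSereginSverak2003, §3 (3.26)–(3.32)] [cite: WangZhang2016, §4 Step 3] -/
theorem farField_representative_of_local_pressure
    (hw : ∀ a : ℝ, 0 < a →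
      IsSuitableWeakSolutionInBall a (0 : ℝ × EuclideanSpace ℝ (Fin 3)) w π)
    {P : ℝ≥0} (hP : ∀ z₀ : ℝ × EuclideanSpace ℝ (Fin 3), z₀.1 ≤ 0 →
      ∫⁻ q in parabolicCylinder 1 z₀, ‖π q.1 q.2‖ₑ ^ (3 / 2 : ℝ) ≤ P)
    (htop : ∀ φ : EuclideanSpace ℝ (Fin 3) → EuclideanSpace ℝ (Fin 3), ContDiff ℝ (⊤ : ℕ∞) φ →
      HasCompactSupport φ → ∀ ε : ℝ, 0 < ε →
        ∃ s₀ : ℝ, s₀ < 0 ∧ ∀ᵐ s ∂(volume.restrict (Ioo s₀ 0)), |∫ y, ⟪w s y, φ y⟫| ≤ ε)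
    {R₀ : ℝ} (hR₀ : 0 < R₀)
    (hfar : ∀ᵐ z ∂(volume.restrict
      (Ioo (-2 : ℝ) 0 ×ˢ (closedBall (0 : EuclideanSpace ℝ (Fin 3)) R₀)ᶜ)), ‖w z.1 z.2‖ ≤ 1) :
    ∃ Uf : ℝ → EuclideanSpace ℝ (Fin 3) → EuclideanSpace ℝ (Fin 3),
      uncurry Uf =ᵐ[volume.restrict
        (Ioo (-1 : ℝ) 0 ×ˢ (closedBall (0 : EuclideanSpace ℝ (Fin 3)) (R₀ + 1))ᶜ)] uncurry w ∧
      ContinuousOn (uncurry Uf)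
        (Ioo (-1 : ℝ) 0 ×ˢ (closedBall (0 : EuclideanSpace ℝ (Fin 3)) (R₀ + 1))ᶜ) ∧
      ∀ z ∈ Ioo (-1 : ℝ) 0 ×ˢ {x : EuclideanSpace ℝ (Fin 3) | R₀ + 1 + 1 < ‖x‖},
        curl (Uf z.1) z.2 = 0 := by
  -- the thickening condition and the bound in the required shape
  have hSS' : ∀ x ∈ (closedBall (0 : EuclideanSpace ℝ (Fin 3)) (R₀ + 1))ᶜ,
      ball x (2 * (1 / 2 : ℝ)) ⊆ (closedBall (0 : EuclideanSpace ℝ (Fin 3)) R₀)ᶜ := by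
    intro x hx y hy
    rw [mem_compl_iff, mem_closedBall, dist_zero_right, not_le] at hx ⊢
    rw [mem_ball, dist_eq_norm] at hy
    have : ‖x‖ ≤ ‖y‖ + ‖y - x‖ := by
      calc ‖x‖ = ‖y - (y - x)‖ := by rw [sub_sub_cancel]
        _ ≤ ‖y‖ + ‖y - x‖ := norm_sub_le _ _
    linarith
  have hbd : ∀ᵐ z ∂(volume.restrict (Ioo ((-1 : ℝ) - 4 * (1 / 2 : ℝ) ^ 2) 0 ×ˢ
      (closedBall (0 : EuclideanSpace ℝ (Fin 3)) R₀)ᶜ)), ‖w z.1 z.2‖ ≤ 1 := by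
    rw [show (-1 : ℝ) - 4 * (1 / 2 : ℝ) ^ 2 = -2 by norm_num]
    exact hfar
  obtain ⟨K, U, hUw, hUc, hCD, hjc, hbdK⟩ := exists_representative_of_ae_bound_of_local_pressure
    hw hP isClosed_closedBall.isOpen_compl (by norm_num : (0 : ℝ) < 1 / 2) (by norm_num) le_rfl
    hSS' hbd
  refine ⟨U, hUw, hUc, ?_⟩
  -- notation
  set S : Set (EuclideanSpace ℝ (Fin 3)) := (closedBall (0 : EuclideanSpace ℝ (Fin 3)) (R₀ + 1))ᶜ with hS
  have hSo : IsOpen S := isClosed_closedBall.isOpen_compl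
  set Ω : Set (ℝ × EuclideanSpace ℝ (Fin 3)) := Ioo (-1 : ℝ) 0 ×ˢ S with hΩ
  have hΩo : IsOpen Ω := isOpen_Ioo.prod hSo
  -- the equations hold for the representative
  have hsolw : IsDistributionalNSSolutionOn ⟨Ω, hΩo⟩ 1 0 w π :=
    isDistributionalNSSolutionOn_of_forall_cylinder (fun a' ha' => (hw a' ha').1.distributional)
      hΩo (prod_mono Ioo_subset_Iio_self (subset_univ _))
  have hsol : IsDistributionalNSSolutionOn ⟨Ω, hΩo⟩ 1 0 U π :=
    hsolw.congr_ae hUw.symm (ae_of_all _ fun _ => rfl)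
  have hU4 : ∀ t ∈ Ioo (-1 : ℝ) 0, ContDiffOn ℝ 4 (U t) S := fun t ht x hx =>
    ((hCD (t, x) ⟨ht, hx⟩).of_le (by norm_cast)).contDiffWithinAt
  have hΦ : ∀ n ≤ 4, ContinuousOn
      (fun z : ℝ × EuclideanSpace ℝ (Fin 3) => iteratedFDeriv ℝ n (U z.1) z.2) Ω := fun n _ => hjc n
  have hK : ∀ n ≤ 3, ∀ z ∈ Ω, ‖iteratedFDeriv ℝ n (U z.1) z.2‖ ≤ K :=
    fun n hn z hz => hbdK n (by omega) z hz
  exact farField_curl_eq_zero (by linarith : (0 : ℝ) ≤ R₀ + 1) htop hUw hsol hU4 hΦ hK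

end FarField

/-! ### The interior step: unique continuation and an abstract Liouville property -/

section Strip

/-- **The interior step with an abstract Liouville property of the slices** (ESS 2003, §3, after
(3.32); Seregin 2014, Ch. 7 p. 139; Wang–Zhang 2017, §4 Step 3 "similar arguments as in [ESS], by
using spatial unique continuation, give `w = 0` in `ℝ³ × (-T, 0)`. Hence `v ≡ 0`"). Let `(w, π)` be
suitable in every `Q(a)` with uniform local pressure bounds, let `Uf` be its far-field representative
on `]-1, 0[ × {|x| > R₁}` with `curl Uf = 0` for `|x| > R₁ + 1`, let `]a, b[ × ℝ³ ⊆ ]-1, 0] × ℝ³` be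
a strip with `|w| ≤ L` a.e. on `]a - 4ρ², b[ × ℝ³` (`0 < ρ ≤ 1/2`), and suppose that for a.e.
`t ∈ ]a, b[` no non-zero entire harmonic field agrees a.e. with `w(t, ·)` (`hL`). Then
`w(s, ·) = 0` a.e. for a.e. `s ∈ ]a, b[`: the smooth representative on the strip has vorticity of
class `C¹₂` with `|∂ₜω - Δω| ≤ 2K(|ω| + |∇ω|)`, vanishing on the far part of the strip, hence at every
time of the strip by unique continuation across the sphere `|x| = R₁ + 1`
(`Carleman.uniqueContinuation_uncurried_c12`); so each slice of the representative is divergence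
free and irrotational, hence harmonic, and for a.e. `t` it agrees a.e. with `w(t, ·)`, so it
vanishes by `hL`. [cite: EscauriazaSereginSverak2003, §3 after (3.32) and Thm. 4.1] [cite: Seregin2014, Ch. 7 p. 139] [cite: WangZhang2016, §4 Step 3] -/
theorem strip_velocity_ae_zero_of_liouville
    (hw : ∀ a : ℝ, 0 < a →
      IsSuitableWeakSolutionInBall a (0 : ℝ × EuclideanSpace ℝ (Fin 3)) w π)
    {P : ℝ≥0} (hP : ∀ z₀ : ℝ × EuclideanSpace ℝ (Fin 3), z₀.1 ≤ 0 →
      ∫⁻ q in parabolicCylinder 1 z₀, ‖π q.1 q.2‖ₑ ^ (3 / 2 : ℝ) ≤ P)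
    {R₁ : ℝ} (hR₁ : 0 < R₁) {Uf : ℝ → EuclideanSpace ℝ (Fin 3) → EuclideanSpace ℝ (Fin 3)}
    (hUf : uncurry Uf =ᵐ[volume.restrict
      (Ioo (-1 : ℝ) 0 ×ˢ (closedBall (0 : EuclideanSpace ℝ (Fin 3)) R₁)ᶜ)] uncurry w)
    (hUfc : ContinuousOn (uncurry Uf)
      (Ioo (-1 : ℝ) 0 ×ˢ (closedBall (0 : EuclideanSpace ℝ (Fin 3)) R₁)ᶜ))
    (hcurl : ∀ z ∈ Ioo (-1 : ℝ) 0 ×ˢ {x : EuclideanSpace ℝ (Fin 3) | R₁ + 1 < ‖x‖},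
      curl (Uf z.1) z.2 = 0)
    {a b ρ L : ℝ} (hρ : 0 < ρ) (hρ1 : 2 * ρ ≤ 1) (ha : -1 ≤ a - 4 * ρ ^ 2) (hb : b ≤ 0)
    (hbd : ∀ᵐ z ∂(volume.restrict
      (Ioo (a - 4 * ρ ^ 2) b ×ˢ (univ : Set (EuclideanSpace ℝ (Fin 3))))), ‖w z.1 z.2‖ ≤ L)
    (hL : ∀ᵐ t ∂(volume.restrict (Ioo a b)),
      ∀ V : EuclideanSpace ℝ (Fin 3) → EuclideanSpace ℝ (Fin 3),
        InnerProductSpace.HarmonicOnNhd V (univ : Set (EuclideanSpace ℝ (Fin 3))) →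
        V =ᵐ[volume] w t → V = 0) :
    ∀ᵐ s ∂(volume.restrict (Ioo a b)), w s =ᵐ[volume] 0 := by
  -- ### the representative on the strip
  set I : Set ℝ := Ioo a b with hIdef
  have hIo : IsOpen I := isOpen_Ioo
  set Ω : Set (ℝ × EuclideanSpace ℝ (Fin 3)) := I ×ˢ (univ : Set (EuclideanSpace ℝ (Fin 3))) with hΩdef
  have hΩo : IsOpen Ω := hIo.prod isOpen_univ
  have hIsub : I ⊆ Ioo (-1 : ℝ) 0 := Ioo_subset_Ioo (by nlinarith [sq_nonneg ρ]) hb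
  obtain ⟨K, U, hUw, hUc, hCD, hjc, hbdK⟩ := exists_representative_of_ae_bound_of_local_pressure
    hw hP (S := univ) (S' := univ) isOpen_univ hρ hρ1 hb (fun x _ => subset_univ _) hbd
  -- the equations hold for the representative
  have hsolw : IsDistributionalNSSolutionOn ⟨Ω, hΩo⟩ 1 0 w π :=
    isDistributionalNSSolutionOn_of_forall_cylinder (fun a' ha' => (hw a' ha').1.distributional)
      hΩo (prod_mono (hIsub.trans Ioo_subset_Iio_self) Subset.rfl)
  have hsol : IsDistributionalNSSolutionOn ⟨Ω, hΩo⟩ 1 0 U π :=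
    hsolw.congr_ae hUw.symm (ae_of_all _ fun _ => rfl)
  have hU4 : ∀ t ∈ I, ContDiffOn ℝ 4 (U t) (univ : Set (EuclideanSpace ℝ (Fin 3))) :=
    fun t ht x _ =>
      ((hCD (t, x) ⟨ht, mem_univ _⟩).of_le (by norm_cast)).contDiffWithinAt
  have hΦ : ∀ n ≤ 4, ContinuousOn
      (fun z : ℝ × EuclideanSpace ℝ (Fin 3) => iteratedFDeriv ℝ n (U z.1) z.2) Ω := fun n _ => hjc n
  have hK₀ : ∀ z ∈ Ω, ‖U z.1 z.2‖ ≤ K := fun z hz => by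
    have h := hbdK 0 (by norm_num) z hz
    rwa [norm_iteratedFDeriv_zero] at h
  have hK₁ : ∀ z ∈ Ω, ‖fderiv ℝ (U z.1) z.2‖ ≤ K := fun z hz => by
    have h := hbdK 1 (by norm_num) z hz
    rwa [norm_iteratedFDeriv_one] at h
  -- ### the vorticity: class `C¹₂`, equation, far-field vanishing
  obtain ⟨hdiv, -, -, hω1, hωx⟩ :=
    vorticity_c12_of_isDistributionalNSSolutionOn hIo isOpen_univ hsol hU4 hΦ
  obtain ⟨-, -, hineq⟩ := vorticity_carleman_inequality hIo isOpen_univ hsol hU4 hΦ hK₀ hK₁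
  have hωbd : ∀ z ∈ Ω, ‖(uncurry (vorticity U)) z‖ ≤ ‖curlCLM‖ * K := fun z hz => by
    show ‖vorticity U z.1 z.2‖ ≤ _
    rw [vorticity_apply]
    exact (norm_curl_le _ _).trans
      (mul_le_mul_of_nonneg_left (hK₁ z hz) (ContinuousLinearMap.opNorm_nonneg curlCLM))
  have hfarΩ : ∀ z ∈ I ×ˢ {x : EuclideanSpace ℝ (Fin 3) | R₁ + 1 < ‖x‖}, vorticity U z.1 z.2 = 0 := by
    set O : Set (ℝ × EuclideanSpace ℝ (Fin 3)) := I ×ˢ (closedBall (0 : EuclideanSpace ℝ (Fin 3)) R₁)ᶜ with hO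
    have hOo : IsOpen O := hIo.prod isClosed_closedBall.isOpen_compl
    have hOΩ : O ⊆ Ω := prod_mono Subset.rfl (subset_univ _)
    have hOF : O ⊆ Ioo (-1 : ℝ) 0 ×ˢ (closedBall (0 : EuclideanSpace ℝ (Fin 3)) R₁)ᶜ :=
      prod_mono hIsub Subset.rfl
    have hae1 : uncurry U =ᵐ[volume.restrict O] uncurry w :=
      ae_restrict_of_ae_restrict_of_subset hOΩ hUw
    have hae2 : uncurry Uf =ᵐ[volume.restrict O] uncurry w :=
      ae_restrict_of_ae_restrict_of_subset hOF hUf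
    have hae : uncurry U =ᵐ[volume.restrict O] uncurry Uf := hae1.trans hae2.symm
    have heqOn : EqOn (uncurry U) (uncurry Uf) O :=
      Measure.eqOn_open_of_ae_eq hae hOo (hUc.mono hOΩ) (hUfc.mono hOF)
    rintro ⟨t, x⟩ ⟨ht, hx⟩
    have hx' : R₁ + 1 < ‖x‖ := hx
    have hxc : x ∈ (closedBall (0 : EuclideanSpace ℝ (Fin 3)) R₁)ᶜ := by
      rw [mem_compl_iff, mem_closedBall, dist_zero_right, not_le]
      linarith
    have hev : U t =ᶠ[𝓝 x] Uf t := slice_eventuallyEq hOo heqOn (w := (t, x)) ⟨ht, hxc⟩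
    show vorticity U t x = 0
    rw [vorticity_apply, curl_eq_curlCLM, hev.fderiv_eq, ← curl_eq_curlCLM]
    exact hcurl (t, x) ⟨hIsub ht, hx'⟩
  -- ### unique continuation across the sphere `|x| = R₁ + 1`, at every time of the strip
  have hωzero : ∀ t ∈ I, ∀ x : EuclideanSpace ℝ (Fin 3), vorticity U t x = 0 := by
    intro t ht x
    by_cases hxfar : R₁ + 1 < ‖x‖
    · exact hfarΩ (t, x) ⟨ht, hxfar⟩
    push Not at hxfar
    -- constants
    have hK0 : 0 ≤ K := (norm_nonneg _).trans (hK₀ (t, 0) ⟨ht, mem_univ _⟩)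
    set e₀ : EuclideanSpace ℝ (Fin 3) := EuclideanSpace.basisFun (Fin 3) ℝ 0 with he₀
    have he₀n : ‖e₀‖ = 1 := (EuclideanSpace.basisFun (Fin 3) ℝ).orthonormal.1 0
    set x₁ : EuclideanSpace ℝ (Fin 3) := (R₁ + 3) • e₀ with hx₁
    have hx₁n : ‖x₁‖ = R₁ + 3 := by
      rw [hx₁, norm_smul, he₀n, mul_one, Real.norm_eq_abs, abs_of_pos (by linarith)]
    set Rb : ℝ := 2 * R₁ + 10 with hRb
    have hRbpos : 0 < Rb := by positivity
    set T' : ℝ := t - a with hT'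
    have hT'pos : 0 < T' := by have := ht.1; simp only [hT']; linarith
    -- the affine map `A(s, y) = (t - s, x₁ + y)`
    set A : ℝ × EuclideanSpace ℝ (Fin 3) → ℝ × EuclideanSpace ℝ (Fin 3) := stAffine (-1) 1 t x₁ with hAdef
    have hA1 : ∀ z : ℝ × EuclideanSpace ℝ (Fin 3), (A z).1 = t - z.1 := fun z => by
      show t + (-1) * z.1 = t - z.1; ring
    have hA2 : ∀ z : ℝ × EuclideanSpace ℝ (Fin 3), (A z).2 = x₁ + z.2 := fun z => by
      show x₁ + (1 : ℝ) • z.2 = x₁ + z.2; rw [one_smul]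
    set Q' : Set (ℝ × EuclideanSpace ℝ (Fin 3)) := Ioo (0 : ℝ) T' ×ˢ ball (0 : EuclideanSpace ℝ (Fin 3)) Rb with hQ'
    have hAΩ' : ∀ z ∈ Ico (0 : ℝ) T' ×ˢ ball (0 : EuclideanSpace ℝ (Fin 3)) Rb, A z ∈ Ω := by
      rintro ⟨s, y⟩ ⟨hs, -⟩
      refine ⟨?_, mem_univ _⟩
      rw [hA1]
      have h1 := hs.1
      have h2 := hs.2
      simp only [hT'] at h2
      exact ⟨by simp only; linarith, by simp only; linarith [ht.2]⟩
    have hAΩ : ∀ z ∈ Q', A z ∈ Ω := fun z hz => hAΩ' z ⟨Ioo_subset_Ico_self hz.1, hz.2⟩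
    -- the transported vorticity
    set ω : ℝ × EuclideanSpace ℝ (Fin 3) → EuclideanSpace ℝ (Fin 3) := uncurry (vorticity U) with hωdef
    set u : ℝ × EuclideanSpace ℝ (Fin 3) → EuclideanSpace ℝ (Fin 3) := fun z => ω (A z) with hudef
    have hu1 : ContDiffOn ℝ 1 u Q' :=
      (Carleman.contDiffOn_comp_stAffine hω1 (-1) 1 t x₁).mono fun z hz => hAΩ z hz
    have hdxu : ∀ e : EuclideanSpace ℝ (Fin 3), Carleman.dx e u = fun z => Carleman.dx e ω (A z) := by
      intro e
      funext z
      rw [hudef, Carleman.dx_comp_stAffine (by norm_num) one_ne_zero ω e z, one_smul]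
    have hux : ∀ e : EuclideanSpace ℝ (Fin 3), ContDiffOn ℝ 1 (Carleman.dx e u) Q' := by
      intro e
      rw [hdxu e]
      exact (Carleman.contDiffOn_comp_stAffine (hωx e) (-1) 1 t x₁).mono fun z hz => hAΩ z hz
    have hucont : ContinuousOn u (Ico (0 : ℝ) T' ×ˢ ball (0 : EuclideanSpace ℝ (Fin 3)) Rb) :=
      (Carleman.continuousOn_comp_stAffine hω1.continuousOn (-1) 1 t x₁).mono fun z hz => hAΩ' z hz
    have hdtu : ∀ z, Carleman.dt u z = (-1 : ℝ) • Carleman.dt ω (A z) := fun z => by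
      rw [hudef, Carleman.dt_comp_stAffine (by norm_num) one_ne_zero]
    have hlapu : ∀ z, Carleman.lap u z = Carleman.lap ω (A z) := fun z => by
      rw [hudef, Carleman.lap_comp_stAffine (by norm_num) one_ne_zero, one_pow, one_smul]
    have hgradu : ∀ z, Carleman.gradSq u z = Carleman.gradSq ω (A z) := fun z => by
      rw [hudef, Carleman.gradSq_comp_stAffine (by norm_num) one_ne_zero, one_pow, one_mul]
    have hinequ : ∀ z ∈ Q', ‖Carleman.dt u z + Carleman.lap u z‖ ≤
        (K + K) * (‖u z‖ + Real.sqrt (Carleman.gradSq u z)) := by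
      intro z hz
      rw [hdtu z, hlapu z, hgradu z]
      have e1 : (-1 : ℝ) • Carleman.dt ω (A z) + Carleman.lap ω (A z) =
          -(Carleman.dt ω (A z) - Carleman.lap ω (A z)) := by
        rw [neg_one_smul]; abel
      rw [e1, norm_neg]
      exact hineq (A z) (hAΩ z hz)
    have hvan : ∀ k : ℕ, ∃ C : ℝ, ∀ z ∈ Q', ‖u z‖ ≤ C * (‖z.2‖ + Real.sqrt z.1) ^ k := by
      intro k
      refine ⟨‖curlCLM‖ * K, fun z hz => ?_⟩
      have hbase : 0 ≤ ‖z.2‖ + Real.sqrt z.1 := by positivity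
      by_cases hy : ‖z.2‖ < 2
      · -- near the apex the transported vorticity vanishes identically
        have hfar' : R₁ + 1 < ‖x₁ + z.2‖ := by
          have h := norm_sub_le (x₁ + z.2) z.2
          rw [add_sub_cancel_right, hx₁n] at h
          linarith
        have h0 : u z = 0 := by
          have h := hfarΩ (A z) ⟨(hAΩ z hz).1, by rw [hA2]; exact hfar'⟩
          show ω (A z) = 0
          exact h
        rw [h0, norm_zero]
        positivity
      · push Not at hy
        have h1 : (1 : ℝ) ≤ (‖z.2‖ + Real.sqrt z.1) ^ k :=
          one_le_pow₀ (by linarith [Real.sqrt_nonneg z.1])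
        calc ‖u z‖ = ‖ω (A z)‖ := rfl
          _ ≤ ‖curlCLM‖ * K := hωbd _ (hAΩ z hz)
          _ = ‖curlCLM‖ * K * 1 := (mul_one _).symm
          _ ≤ ‖curlCLM‖ * K * (‖z.2‖ + Real.sqrt z.1) ^ k :=
              mul_le_mul_of_nonneg_left h1 (by positivity)
    have huc := Carleman.uniqueContinuation_uncurried_c12 3 3 (c₁ := K + K) (R := Rb) (T := T')
      (by positivity) hRbpos hT'pos hu1 hux hucont hinequ hvan
    -- evaluate at `y = x - x₁`
    have hy : x - x₁ ∈ ball (0 : EuclideanSpace ℝ (Fin 3)) Rb := by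
      rw [mem_ball_zero_iff]
      calc ‖x - x₁‖ ≤ ‖x‖ + ‖x₁‖ := norm_sub_le _ _
        _ < Rb := by rw [hx₁n, hRb]; linarith
    have h := huc (x - x₁) hy
    have hA0 : A (0, x - x₁) = (t, x) := by
      show (t + (-1) * (0 : ℝ), x₁ + (1 : ℝ) • (x - x₁)) = (t, x)
      simp
    have h' : ω (A (0, x - x₁)) = 0 := h
    rw [hA0] at h'
    exact h'
  -- ### the velocity slices are harmonic
  have hharm : ∀ t ∈ I, InnerProductSpace.HarmonicOnNhd (U t) (univ : Set (EuclideanSpace ℝ (Fin 3))) := by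
    intro t ht x _
    have hcd : ContDiff ℝ 2 (U t) := contDiff_iff_contDiffAt.2 fun y =>
      (hCD (t, y) ⟨ht, mem_univ _⟩).of_le (by norm_cast)
    have hΔ : ∀ y, Δ (U t) y = 0 :=
      laplacian_eq_zero_of_curl_eq_zero_of_isDivFree hcd
        (fun y => by rw [← vorticity_apply]; exact hωzero t ht y)
        (fun y => hdiv (t, y) ⟨ht, mem_univ _⟩)
    show InnerProductSpace.HarmonicAt (U t) x
    constructor
    · exact hcd.contDiffAt
    · exact Filter.Eventually.of_forall fun y => by rw [Pi.zero_apply]; exact hΔ y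
  -- ### a.e. slice: `U(t) = w(t)` a.e., so `U(t) = 0` by the Liouville property
  have hslice : ∀ᵐ t ∂(volume.restrict I), U t =ᵐ[volume] w t := by
    have h1 : ∀ᵐ z ∂((volume.restrict I).prod (volume : Measure (EuclideanSpace ℝ (Fin 3)))),
        uncurry U z = uncurry w z := by
      rw [Measure.restrict_prod_eq_prod_univ, ← Measure.volume_eq_prod]
      exact hUw
    filter_upwards [Measure.ae_ae_of_ae_prod h1] with t ht
    filter_upwards [ht] with x hx
    exact hx
  filter_upwards [ae_restrict_mem measurableSet_Ioo, hslice, hL] with t ht hUt hLt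
  have hU0 : U t = 0 := hLt (U t) (hharm t ht) hUt
  filter_upwards [hUt] with x hx
  rw [← hx, hU0]

end Strip

/-! ### The endgame -/

section Endgame

/-- **Vanishing of a local energy ancient solution near the top time** (ESS 2003, §3, proof of
Thm. 1.4, concluding argument; Seregin 2014, §6.6 Thm. 6.21 and Ch. 7 p. 139; Wang–Zhang 2017, §4
Steps 1–3), with local pressure bounds and an abstract Liouville property. Let `(w, π)` be a
suitable weak solution in every `Q(a)`, `a > 0`, with `∫_{Q(z₀,1)} |π|^{3/2} ≤ P` for all apices
`z₀`, `t₀ ≤ 0`; suppose `w` vanishes weakly at the top time (`htop`), `|w| ≤ 1` a.e. on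
`]-2, 0[ × {|x| > R₀}` (`hfar`), and for a.e. `t ∈ ]-1, 0[` no non-zero entire harmonic field
agrees a.e. with `w(t, ·)` (`hL`). Then `w(t, ·) = 0` a.e. for a.e. `t ∈ ]-1, 0[`. Proof: the
far-field vorticity of the far-field representative vanishes
(`farField_representative_of_local_pressure`); by the CKN theorem almost every time
`t ∈ ]-1, 0[` is regular (`ae_forall_isRegularPoint`) and carries a bounded strip
(`exists_strip_bound`), on which `w = 0` a.e. (`strip_velocity_ae_zero_of_liouville`); a set of
times which is locally null around a.e. point is null. [cite: EscauriazaSereginSverak2003, Thm. 1.4, §3] [cite: Seregin2014, §6.6 Thm. 6.21, Ch. 7 p. 139] [cite: WangZhang2016, §4 Steps 1–3] -/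
theorem ancient_ae_slice_zero_of_farField_of_top_of_liouville
    (hw : ∀ a : ℝ, 0 < a →
      IsSuitableWeakSolutionInBall a (0 : ℝ × EuclideanSpace ℝ (Fin 3)) w π)
    {P : ℝ≥0} (hP : ∀ z₀ : ℝ × EuclideanSpace ℝ (Fin 3), z₀.1 ≤ 0 →
      ∫⁻ q in parabolicCylinder 1 z₀, ‖π q.1 q.2‖ₑ ^ (3 / 2 : ℝ) ≤ P)
    (htop : ∀ φ : EuclideanSpace ℝ (Fin 3) → EuclideanSpace ℝ (Fin 3), ContDiff ℝ (⊤ : ℕ∞) φ →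
      HasCompactSupport φ → ∀ ε : ℝ, 0 < ε →
        ∃ s₀ : ℝ, s₀ < 0 ∧ ∀ᵐ s ∂(volume.restrict (Ioo s₀ 0)), |∫ y, ⟪w s y, φ y⟫| ≤ ε)
    {R₀ : ℝ} (hR₀ : 0 < R₀)
    (hfar : ∀ᵐ z ∂(volume.restrict
      (Ioo (-2 : ℝ) 0 ×ˢ (closedBall (0 : EuclideanSpace ℝ (Fin 3)) R₀)ᶜ)), ‖w z.1 z.2‖ ≤ 1)
    (hL : ∀ᵐ t ∂(volume.restrict (Ioo (-1 : ℝ) 0)),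
      ∀ V : EuclideanSpace ℝ (Fin 3) → EuclideanSpace ℝ (Fin 3),
        InnerProductSpace.HarmonicOnNhd V (univ : Set (EuclideanSpace ℝ (Fin 3))) →
        V =ᵐ[volume] w t → V = 0) :
    ∀ᵐ t ∂(volume.restrict (Ioo (-1 : ℝ) 0)), w t =ᵐ[volume] 0 := by
  -- ### the far field
  obtain ⟨Uf, hUf, hUfc, hcurl⟩ := farField_representative_of_local_pressure hw hP htop hR₀ hfar
  have hfar1 : ∀ᵐ z ∂(volume.restrict
      (Ioo (-1 : ℝ) 0 ×ˢ (closedBall (0 : EuclideanSpace ℝ (Fin 3)) R₀)ᶜ)), ‖w z.1 z.2‖ ≤ 1 :=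
    ae_restrict_of_ae_restrict_of_subset (prod_mono (Ioo_subset_Ioo (by norm_num) le_rfl) Subset.rfl) hfar
  -- ### regular times and their strips
  set a₂ : ℝ := R₀ + 2 with ha₂
  have ha₂pos : 0 < a₂ := by positivity
  have hreg : ∀ᵐ t ∂(volume.restrict (Ioo (-1 : ℝ) 0)),
      ∀ x ∈ ball (0 : EuclideanSpace ℝ (Fin 3)) a₂, IsRegularPoint w (t, x) := by
    have hsub : Ioo (-1 : ℝ) 0 ⊆ Ioo (-a₂ ^ 2) 0 := Ioo_subset_Ioo (by nlinarith) le_rfl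
    exact ae_restrict_of_ae_restrict_of_subset hsub (ae_forall_isRegularPoint (hw a₂ ha₂pos).1)
  -- the bad times
  set Ibad : Set ℝ := {s | ¬ (w s =ᵐ[volume] 0)} with hIbad
  have hG : ∀ᵐ t ∂(volume.restrict (Ioo (-1 : ℝ) 0)),
      ∃ J : Set ℝ, IsOpen J ∧ t ∈ J ∧ volume (Ibad ∩ J) = 0 := by
    filter_upwards [ae_restrict_mem measurableSet_Ioo, hreg] with t ht hregt
    have hregc : ∀ x ∈ closedBall (0 : EuclideanSpace ℝ (Fin 3)) (R₀ + 1), IsRegularPoint w (t, x) :=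
      fun x hx => hregt x (by
        rw [mem_closedBall, dist_zero_right] at hx
        rw [mem_ball_zero_iff, ha₂]; linarith)
    obtain ⟨τ, hτ, hτsub, L, hL'⟩ := exists_strip_bound hfar1 hregc ht
    have hτ1 : -1 ≤ t - τ := ((Ioo_subset_Ioo_iff (by linarith)).1 hτsub).1
    have hτ2 : t + τ ≤ 0 := ((Ioo_subset_Ioo_iff (by linarith)).1 hτsub).2
    -- the strip `]t - τ/2, t + τ/2[` with `ρ = √τ/4 ≤ 1/4`
    have hτle : τ ≤ 1 := by linarith [ht.2]
    set ρ : ℝ := Real.sqrt τ / 4 with hρdef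
    have hρ : 0 < ρ := by positivity
    have hρsq : 4 * ρ ^ 2 = τ / 4 := by
      rw [hρdef, div_pow, Real.sq_sqrt hτ.le]; ring
    have hρ1 : 2 * ρ ≤ 1 := by
      have h1 : Real.sqrt τ ≤ 1 := Real.sqrt_le_one.mpr hτle
      rw [hρdef]; linarith [Real.sqrt_nonneg τ]
    have hbd : ∀ᵐ z ∂(volume.restrict
        (Ioo (t - τ / 2 - 4 * ρ ^ 2) (t + τ / 2) ×ˢ (univ : Set (EuclideanSpace ℝ (Fin 3))))),
        ‖w z.1 z.2‖ ≤ L := by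
      refine ae_restrict_of_ae_restrict_of_subset (prod_mono (Ioo_subset_Ioo ?_ ?_) Subset.rfl) hL'
      · rw [hρsq]; linarith
      · linarith
    have hJsub : Ioo (t - τ / 2) (t + τ / 2) ⊆ Ioo (-1 : ℝ) 0 := Ioo_subset_Ioo (by linarith) (by linarith)
    have hLJ : ∀ᵐ s ∂(volume.restrict (Ioo (t - τ / 2) (t + τ / 2))),
        ∀ V : EuclideanSpace ℝ (Fin 3) → EuclideanSpace ℝ (Fin 3),
          InnerProductSpace.HarmonicOnNhd V (univ : Set (EuclideanSpace ℝ (Fin 3))) →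
          V =ᵐ[volume] w s → V = 0 :=
      ae_restrict_of_ae_restrict_of_subset hJsub hL
    have hstrip := strip_velocity_ae_zero_of_liouville hw hP (by linarith : (0 : ℝ) < R₀ + 1) hUf hUfc
      hcurl hρ hρ1 (by rw [hρsq]; linarith) (by linarith) hbd hLJ
    refine ⟨Ioo (t - τ / 2) (t + τ / 2), isOpen_Ioo, ⟨by linarith, by linarith⟩, ?_⟩
    rw [← Measure.restrict_apply' measurableSet_Ioo]
    exact ae_iff.1 hstrip
  have hnull : volume (Ibad ∩ Ioo (-1 : ℝ) 0) = 0 := by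
    set G : Set ℝ := {t | ∃ J : Set ℝ, IsOpen J ∧ t ∈ J ∧ volume (Ibad ∩ J) = 0} with hGdef
    have h1 : volume.restrict (Ioo (-1 : ℝ) 0) {t | ¬ (∃ J : Set ℝ, IsOpen J ∧ t ∈ J ∧
        volume (Ibad ∩ J) = 0)} = 0 := ae_iff.1 hG
    rw [Measure.restrict_apply' measurableSet_Ioo] at h1
    have h2 : volume (Ibad ∩ G) = 0 := by
      refine measure_null_of_locally_null _ fun t ht => ?_
      obtain ⟨J, hJo, htJ, hJ0⟩ := ht.2
      have hsub : (Ibad ∩ G) ∩ J ⊆ Ibad ∩ J := fun s hs => ⟨hs.1.1, hs.2⟩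
      exact ⟨(Ibad ∩ G) ∩ J, inter_mem_nhdsWithin _ (hJo.mem_nhds htJ), measure_mono_null hsub hJ0⟩
    refine measure_mono_null (fun s hs => ?_) (measure_union_null h2 h1)
    by_cases hsG : s ∈ G
    · exact Or.inl ⟨hs.1, hsG⟩
    · exact Or.inr ⟨hsG, hs.2⟩
  rw [ae_iff, Measure.restrict_apply' measurableSet_Ioo]
  exact hnull

/-- **The ancient solution vanishes on `Q(1/2)`**: under the hypotheses of
`ancient_ae_slice_zero_of_farField_of_top_of_liouville`, `∫_{Q(1/2)} |w|³ = 0` — the shape that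
contradicts the non-triviality `∫_{Q(1/2)} |w|³ ≥ η/4 > 0` of a blow-up limit at a point of
`ε`-concentration (`blowup_lintegral_cube_ge_of`). [cite: EscauriazaSereginSverak2003, Thm. 1.4, §3] [cite: WangZhang2016, §4 Step 3] -/
theorem ancient_lintegral_cube_half_eq_zero_of_farField_of_top_of_liouville
    (hw : ∀ a : ℝ, 0 < a →
      IsSuitableWeakSolutionInBall a (0 : ℝ × EuclideanSpace ℝ (Fin 3)) w π)
    {P : ℝ≥0} (hP : ∀ z₀ : ℝ × EuclideanSpace ℝ (Fin 3), z₀.1 ≤ 0 →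
      ∫⁻ q in parabolicCylinder 1 z₀, ‖π q.1 q.2‖ₑ ^ (3 / 2 : ℝ) ≤ P)
    (htop : ∀ φ : EuclideanSpace ℝ (Fin 3) → EuclideanSpace ℝ (Fin 3), ContDiff ℝ (⊤ : ℕ∞) φ →
      HasCompactSupport φ → ∀ ε : ℝ, 0 < ε →
        ∃ s₀ : ℝ, s₀ < 0 ∧ ∀ᵐ s ∂(volume.restrict (Ioo s₀ 0)), |∫ y, ⟪w s y, φ y⟫| ≤ ε)
    {R₀ : ℝ} (hR₀ : 0 < R₀)
    (hfar : ∀ᵐ z ∂(volume.restrict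
      (Ioo (-2 : ℝ) 0 ×ˢ (closedBall (0 : EuclideanSpace ℝ (Fin 3)) R₀)ᶜ)), ‖w z.1 z.2‖ ≤ 1)
    (hL : ∀ᵐ t ∂(volume.restrict (Ioo (-1 : ℝ) 0)),
      ∀ V : EuclideanSpace ℝ (Fin 3) → EuclideanSpace ℝ (Fin 3),
        InnerProductSpace.HarmonicOnNhd V (univ : Set (EuclideanSpace ℝ (Fin 3))) →
        V =ᵐ[volume] w t → V = 0) :
    ∫⁻ z in parabolicCylinder (1 / 2) (0 : ℝ × EuclideanSpace ℝ (Fin 3)),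
      ‖w z.1 z.2‖ₑ ^ (3 : ℕ) = 0 := by
  have hae0 : ∀ᵐ t ∂(volume.restrict (Ioo (-(1 / 4 : ℝ)) 0)), w t =ᵐ[volume] 0 :=
    ae_restrict_of_ae_restrict_of_subset (Ioo_subset_Ioo (by norm_num) le_rfl)
      (ancient_ae_slice_zero_of_farField_of_top_of_liouville hw hP htop hR₀ hfar hL)
  have hwm : AEStronglyMeasurable (uncurry w)
      (volume.restrict (parabolicCylinder (1 / 2) (0 : ℝ × EuclideanSpace ℝ (Fin 3)))) :=
    (hw _ (by norm_num)).1.distributional.1.aestronglyMeasurable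
  have hQ : parabolicCylinder (1 / 2) (0 : ℝ × EuclideanSpace ℝ (Fin 3)) =
      Ioo (-(1 / 4 : ℝ)) 0 ×ˢ ball (0 : EuclideanSpace ℝ (Fin 3)) (1 / 2) := by
    rw [parabolicCylinder]
    simp only [Prod.fst_zero, Prod.snd_zero, zero_sub]
    norm_num
  have hf : AEMeasurable (fun z : ℝ × EuclideanSpace ℝ (Fin 3) => ‖w z.1 z.2‖ₑ ^ (3 : ℕ))
      ((volume.restrict (Ioo (-(1 / 4 : ℝ)) 0)).prod
        (volume.restrict (ball (0 : EuclideanSpace ℝ (Fin 3)) (1 / 2)))) := by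
    rw [Measure.prod_restrict, ← Measure.volume_eq_prod, ← hQ]
    exact hwm.enorm.pow_const 3
  rw [hQ, Measure.volume_eq_prod, ← Measure.prod_restrict, lintegral_prod _ hf]
  refine (lintegral_congr_ae ?_).trans lintegral_zero
  filter_upwards [hae0] with t ht
  refine (lintegral_congr_ae ?_).trans lintegral_zero
  filter_upwards [ae_restrict_of_ae ht] with x hx
  simp [hx]

end Endgame

end Literature.Analysis.FluidPDE

end
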